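import Summits.SmoothPoincare4.SmoothPoincare4.Theorems.CongruenceShadowsNilpotentShadowsStandardJohnsonClassTwo
import Summits.SmoothPoincare4.SmoothPoincare4.Theorems.CongruenceShadowsNilpotentShadowsStandardGlueNilpotentBasis
import Summits.SmoothPoincare4.SmoothPoincare4.Theorems.CongruenceShadowsNilpotentShadowsStandardGlueContraction
import Summits.SmoothPoincare4.SmoothPoincare4.Theorems.CongruenceShadowsNilpotentShadowsStandardGlueReading
import Literature.Topology.FourManifolds.SurfaceGroupAbelianisationKernels
import Mathlib.Data.Fintype.BigOperators
import HarnessLib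

/-!
# Helper for stub `stub_layerStepOneZero` (line `nilpotent-genus-class`, crux
`CongruenceShadows.ShadowApproximation`, item stmt-SmoothPoincare4-14595):
# Johnson values of Goeritz conjugates of seed realisers (class-2 multilinear calculus)

`S = SurfaceGroup g`, letters `x : Fin g × Bool` (`(j,false) = aⱼ`, `(j,true) = bⱼ`), `ab : S ↠ H₁ = ℤ^{Fin g × Bool}`
(`SurfaceGroup.abelianize`), `Q = S ⧸ γ₃ S` (`γₖ₊₁ = (⊤).lowerCentralSeries k`), `Z = center Q` (a commutative
group containing `γ₂ S ⧸ γ₃ S`), and the symplectic pairing of letters `⟨x, y⟩ ∈ {0, ±1}` (`⟨aⱼ, bⱼ⟩ = 1`).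

* `hom_apply_eq_prod_zpow` — a homomorphism `f : S → A` to a COMMUTATIVE group is determined by the letters
  through the abelianisation: `f s = ∏ₓ f(x) ^ (ab s)ₓ`.
* `quot_commutator_eq_prod_zpow` — BILINEAR EXPANSION modulo `γ₃`: `⁅s, t⁆ ≡ ∏_{p,q} ⁅p, q⁆ ^ ((ab s)_p (ab t)_q)`.
* `ia_quot_eq_prod_zpow` — the Johnson value of an IA-automorphism `ψ` at any `s` is `∏ₓ (ψ(x)x⁻¹) ^ (ab s)ₓ`.
* `johnson_conj_seed` — **the conjugation formula**: if `ψ` realises the letter triple `(u, v, r)`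
  (`ψ(x)x⁻¹ ≡ ⁅v,r⁆^⟨x,u⟩ ⁅r,u⁆^⟨x,v⟩ ⁅u,v⁆^⟨x,r⟩`, i.e. `τ₁(ψ) = u ∧ v ∧ r`) and the automorphism `φ` acts on
  `H₁` by the integer matrix `M` (`ab (φ x) = M eₓ`) with inverse acting by `M'`, then for every letter `t`
  `(φ ψ φ⁻¹)(t) t⁻¹ ≡ ∏_{p,q} ⁅p, q⁆ ^ E(t,p,q)`,
  `E(t,p,q) = A_u M_{pv} M_{qr} + A_v M_{pr} M_{qu} + A_r M_{pu} M_{qv}`, `A_z = ∑ₓ M'_{xt} ⟨x, z⟩`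
  (the `Aut`-equivariance `τ₁(φψφ⁻¹) = φ_* τ₁(ψ)` written out in coordinates; no symplecticity of `M` is needed).
Pure algebra over the landed class-2 calculus (`…JohnsonClassTwo`, `…GlueNilpotentBasis`); no definitions.
-/

set_option linter.dupNamespace false

open Subgroup Literature.Topology.FourManifolds Multiplicative
open Summit.SmoothPoincare4.SmoothPoincare4.Theorems.NilpotentShadowsStandard.SaturatedTorsorDescent
open scoped commutatorElement IsMulCommutative

namespace Summit.SmoothPoincare4.SmoothPoincare4.Theorems.ShadowApproximation.NilpotentGenusClass

/-! ## Big-operator bookkeeping in a commutative group -/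

section CommGroupLemmas

variable {A : Type*} [CommGroup A] {ι : Type*}

/-- `a ^ (∑ f) = ∏ a ^ f`. [folklore] -/
theorem zpow_finset_sum (a : A) (s : Finset ι) (f : ι → ℤ) :
    a ^ (∑ i ∈ s, f i) = ∏ i ∈ s, a ^ f i := by
  classical
  induction s using Finset.induction_on with
  | empty => simp
  | insert i s hi ih => rw [Finset.sum_insert hi, Finset.prod_insert hi, zpow_add, ih]

end CommGroupLemmas

/-! ## Homomorphisms to commutative groups factor through the letters -/

section Letters

variable {g : ℕ}

/-- **A homomorphism from `S_g` to a commutative group is read off the letters through `ab`**: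
`f s = ∏ₓ f(x) ^ (ab s)ₓ`. [folklore] -/
theorem hom_apply_eq_prod_zpow {A : Type*} [CommGroup A] (f : (SurfaceGroup g) →* A) (s : (SurfaceGroup g)) :
    f s = ∏ x : Fin g × Bool, f (PresentedGroup.of x) ^ (toAdd (SurfaceGroup.abelianize g s) x) := by
  set R : (SurfaceGroup g) →* A :=
    { toFun := fun s => ∏ x : Fin g × Bool, f (PresentedGroup.of x) ^ (toAdd (SurfaceGroup.abelianize g s) x)
      map_one' := by simp
      map_mul' := fun a b => by
        simp only [map_mul, toAdd_mul, Pi.add_apply, zpow_add, Finset.prod_mul_distrib] } with hR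
  have key : f = R := PresentedGroup.ext fun x => by
    simp only [hR, MonoidHom.coe_mk, OneHom.coe_mk, SurfaceGroup.abelianize_of, toAdd_ofAdd]
    rw [Finset.prod_eq_single x (fun y _ hy => by rw [Pi.single_eq_of_ne hy, zpow_zero])
      (fun h => (h (Finset.mem_univ x)).elim), Pi.single_eq_same, zpow_one]
  exact DFunLike.congr_fun key s

end Letters

/-! ## The centre of `S ⧸ γ₃ S`: Johnson values and the bilinear expansion -/

section ClassTwo

variable {g : ℕ}

/-- **The Johnson value of an IA-automorphism at any element**: `ψ(s) s⁻¹ ≡ ∏ₓ (ψ(x) x⁻¹) ^ (ab s)ₓ (mod γ₃)`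
(`cJ x` = the class of `ψ(x) x⁻¹` in the centre). [folklore] -/
theorem ia_quot_eq_prod_zpow (ψ : (SurfaceGroup g) ≃* (SurfaceGroup g)) (hψ : ∀ s : (SurfaceGroup g), ψ s * s⁻¹ ∈ ((⊤ : Subgroup (SurfaceGroup g)).lowerCentralSeries 1))
    (cJ : Fin g × Bool → (Subgroup.center (SurfaceGroup g ⧸ (⊤ : Subgroup (SurfaceGroup g)).lowerCentralSeries 2)))
    (hcJ : ∀ x, (cJ x : (SurfaceGroup g ⧸ (⊤ : Subgroup (SurfaceGroup g)).lowerCentralSeries 2)) = ((ψ (PresentedGroup.of x) * (PresentedGroup.of x)⁻¹ : (SurfaceGroup g)) : (SurfaceGroup g ⧸ (⊤ : Subgroup (SurfaceGroup g)).lowerCentralSeries 2)))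
    (s : (SurfaceGroup g)) :
    ((ψ s * s⁻¹ : (SurfaceGroup g)) : (SurfaceGroup g ⧸ (⊤ : Subgroup (SurfaceGroup g)).lowerCentralSeries 2)) = ((∏ x : Fin g × Bool, cJ x ^ (toAdd (SurfaceGroup.abelianize g s) x) : (Subgroup.center (SurfaceGroup g ⧸ (⊤ : Subgroup (SurfaceGroup g)).lowerCentralSeries 2))) : (SurfaceGroup g ⧸ (⊤ : Subgroup (SurfaceGroup g)).lowerCentralSeries 2)) := by
  set J : (SurfaceGroup g) →* (Subgroup.center (SurfaceGroup g ⧸ (⊤ : Subgroup (SurfaceGroup g)).lowerCentralSeries 2)) :=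
    { toFun := fun s => ⟨((ψ s * s⁻¹ : (SurfaceGroup g)) : (SurfaceGroup g ⧸ (⊤ : Subgroup (SurfaceGroup g)).lowerCentralSeries 2)), mk_lcs_mem_center (hψ s)⟩
      map_one' := Subtype.ext (by simp only [map_one, inv_one, mul_one, QuotientGroup.mk_one]; rfl)
      map_mul' := fun a b => Subtype.ext (by
        simp only [Subgroup.coe_mul]
        exact ia_quot_mul hψ a b) } with hJ
  have hJof : ∀ x, J (PresentedGroup.of x) = cJ x := fun x => Subtype.ext (by rw [hcJ]; rfl)
  have h := hom_apply_eq_prod_zpow J s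
  simp only [hJof] at h
  exact congrArg (fun z : (Subgroup.center (SurfaceGroup g ⧸ (⊤ : Subgroup (SurfaceGroup g)).lowerCentralSeries 2)) => (z : (SurfaceGroup g ⧸ (⊤ : Subgroup (SurfaceGroup g)).lowerCentralSeries 2))) h

/-- **Bilinear expansion of a commutator modulo `γ₃`**:
`⁅s, t⁆ ≡ ∏_{p,q} ⁅p, q⁆ ^ ((ab s)_p · (ab t)_q)` (`cS p q` = the class of `⁅p, q⁆` in the centre). [folklore] -/
theorem quot_commutator_eq_prod_zpow (cS : Fin g × Bool → Fin g × Bool → (Subgroup.center (SurfaceGroup g ⧸ (⊤ : Subgroup (SurfaceGroup g)).lowerCentralSeries 2)))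
    (hcS : ∀ p q, (cS p q : (SurfaceGroup g ⧸ (⊤ : Subgroup (SurfaceGroup g)).lowerCentralSeries 2)) =
      ⁅((PresentedGroup.of p : (SurfaceGroup g)) : (SurfaceGroup g ⧸ (⊤ : Subgroup (SurfaceGroup g)).lowerCentralSeries 2)), ((PresentedGroup.of q : (SurfaceGroup g)) : (SurfaceGroup g ⧸ (⊤ : Subgroup (SurfaceGroup g)).lowerCentralSeries 2))⁆)
    (s t : (SurfaceGroup g)) :
    ((⁅s, t⁆ : (SurfaceGroup g)) : (SurfaceGroup g ⧸ (⊤ : Subgroup (SurfaceGroup g)).lowerCentralSeries 2)) =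
      ((∏ p : Fin g × Bool, ∏ q : Fin g × Bool,
          cS p q ^ (toAdd (SurfaceGroup.abelianize g s) p * toAdd (SurfaceGroup.abelianize g t) q) : (Subgroup.center (SurfaceGroup g ⧸ (⊤ : Subgroup (SurfaceGroup g)).lowerCentralSeries 2))) : (SurfaceGroup g ⧸ (⊤ : Subgroup (SurfaceGroup g)).lowerCentralSeries 2)) := by
  -- `t ↦ ⁅p̄, t̄⁆` for a fixed letter `p`
  have step : ∀ (p : Fin g × Bool) (t : (SurfaceGroup g)),
      (⁅((PresentedGroup.of p : (SurfaceGroup g)) : (SurfaceGroup g ⧸ (⊤ : Subgroup (SurfaceGroup g)).lowerCentralSeries 2)), (t : (SurfaceGroup g ⧸ (⊤ : Subgroup (SurfaceGroup g)).lowerCentralSeries 2))⁆) =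
      ((∏ q : Fin g × Bool, cS p q ^ (toAdd (SurfaceGroup.abelianize g t) q) : (Subgroup.center (SurfaceGroup g ⧸ (⊤ : Subgroup (SurfaceGroup g)).lowerCentralSeries 2))) : (SurfaceGroup g ⧸ (⊤ : Subgroup (SurfaceGroup g)).lowerCentralSeries 2)) := by
    intro p t
    set R : (SurfaceGroup g) →* (Subgroup.center (SurfaceGroup g ⧸ (⊤ : Subgroup (SurfaceGroup g)).lowerCentralSeries 2)) :=
      { toFun := fun t => ⟨⁅((PresentedGroup.of p : (SurfaceGroup g)) : (SurfaceGroup g ⧸ (⊤ : Subgroup (SurfaceGroup g)).lowerCentralSeries 2)), (t : (SurfaceGroup g ⧸ (⊤ : Subgroup (SurfaceGroup g)).lowerCentralSeries 2))⁆, c2_mem_center quot_class_two _ _⟩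
        map_one' := Subtype.ext (by simp only [QuotientGroup.mk_one, commutatorElement_one_right]; rfl)
        map_mul' := fun a b => Subtype.ext (by
          simp only [Subgroup.coe_mul, QuotientGroup.mk_mul]
          exact c2_mul_right quot_class_two _ _ _) } with hR
    have hRof : ∀ q, R (PresentedGroup.of q) = cS p q := fun q => Subtype.ext (by rw [hcS]; rfl)
    have h := hom_apply_eq_prod_zpow R t
    simp only [hRof] at h
    exact congrArg (fun z : (Subgroup.center (SurfaceGroup g ⧸ (⊤ : Subgroup (SurfaceGroup g)).lowerCentralSeries 2)) => (z : (SurfaceGroup g ⧸ (⊤ : Subgroup (SurfaceGroup g)).lowerCentralSeries 2))) h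
  -- `s ↦ ⁅s̄, t̄⁆` for the fixed `t`
  set L : (SurfaceGroup g) →* (Subgroup.center (SurfaceGroup g ⧸ (⊤ : Subgroup (SurfaceGroup g)).lowerCentralSeries 2)) :=
    { toFun := fun s => ⟨⁅(s : (SurfaceGroup g ⧸ (⊤ : Subgroup (SurfaceGroup g)).lowerCentralSeries 2)), (t : (SurfaceGroup g ⧸ (⊤ : Subgroup (SurfaceGroup g)).lowerCentralSeries 2))⁆, c2_mem_center quot_class_two _ _⟩
      map_one' := Subtype.ext (by simp only [QuotientGroup.mk_one, commutatorElement_one_left]; rfl)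
      map_mul' := fun a b => Subtype.ext (by
        simp only [Subgroup.coe_mul, QuotientGroup.mk_mul]
        exact c2_mul_left quot_class_two _ _ _) } with hL
  have hLof : ∀ p, L (PresentedGroup.of p) =
      ∏ q : Fin g × Bool, cS p q ^ (toAdd (SurfaceGroup.abelianize g t) q) := fun p => Subtype.ext (by
    rw [hL]; exact step p t)
  have h := hom_apply_eq_prod_zpow L s
  simp only [hLof, ← Finset.prod_zpow, ← zpow_mul, mul_comm (toAdd (SurfaceGroup.abelianize g t) _)] at h
  rw [quot_commutatorElement]
  exact congrArg (fun z : (Subgroup.center (SurfaceGroup g ⧸ (⊤ : Subgroup (SurfaceGroup g)).lowerCentralSeries 2)) => (z : (SurfaceGroup g ⧸ (⊤ : Subgroup (SurfaceGroup g)).lowerCentralSeries 2))) h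

/-- The image of a letter commutator under an automorphism `φ` acting on `H₁` by the matrix `M`
(`ab (φ p) = ∑ₖ M k p • eₖ`): `φ ⁅p, q⁆ ≡ ∏_{p',q'} ⁅p', q'⁆ ^ (M p' p · M q' q)`. [folklore] -/
theorem quot_equiv_commutator_eq_prod_zpow (φ : (SurfaceGroup g) ≃* (SurfaceGroup g)) (M : Fin g × Bool → Fin g × Bool → ℤ)
    (hM : ∀ x, toAdd (SurfaceGroup.abelianize g (φ (PresentedGroup.of x))) = fun k => M k x)
    (cS : Fin g × Bool → Fin g × Bool → (Subgroup.center (SurfaceGroup g ⧸ (⊤ : Subgroup (SurfaceGroup g)).lowerCentralSeries 2)))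
    (hcS : ∀ p q, (cS p q : (SurfaceGroup g ⧸ (⊤ : Subgroup (SurfaceGroup g)).lowerCentralSeries 2)) =
      ⁅((PresentedGroup.of p : (SurfaceGroup g)) : (SurfaceGroup g ⧸ (⊤ : Subgroup (SurfaceGroup g)).lowerCentralSeries 2)), ((PresentedGroup.of q : (SurfaceGroup g)) : (SurfaceGroup g ⧸ (⊤ : Subgroup (SurfaceGroup g)).lowerCentralSeries 2))⁆)
    (p q : Fin g × Bool) :
    ((φ ⁅(PresentedGroup.of p : (SurfaceGroup g)), PresentedGroup.of q⁆ : (SurfaceGroup g)) : (SurfaceGroup g ⧸ (⊤ : Subgroup (SurfaceGroup g)).lowerCentralSeries 2)) =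
      ((∏ p' : Fin g × Bool, ∏ q' : Fin g × Bool, cS p' q' ^ (M p' p * M q' q) : (Subgroup.center (SurfaceGroup g ⧸ (⊤ : Subgroup (SurfaceGroup g)).lowerCentralSeries 2))) : (SurfaceGroup g ⧸ (⊤ : Subgroup (SurfaceGroup g)).lowerCentralSeries 2)) := by
  rw [map_commutatorElement, quot_commutator_eq_prod_zpow cS hcS, hM p, hM q]

end ClassTwo

/-! ## The conjugation formula -/

section Conj

variable {g : ℕ}

/-- **Johnson values of a conjugated seed realiser** (see the module docstring): for `ψ` realising the
letter triple `(u, v, r)`, `φ` acting on `H₁` by `M` with `φ⁻¹` acting by `M'`, and every letter `t`,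
`(φ ψ φ⁻¹)(t) t⁻¹ ≡ ∏_{p,q} ⁅p,q⁆ ^ (A_u M_{pv} M_{qr} + A_v M_{pr} M_{qu} + A_r M_{pu} M_{qv})`,
`A_z = ∑ₓ M'_{x t} ⟨x, z⟩`. [folklore] -/
theorem johnson_conj_seed (u v r : Fin g × Bool) (ψ φ : (SurfaceGroup g) ≃* (SurfaceGroup g))
    (hψ : ∀ s : (SurfaceGroup g), ψ s * s⁻¹ ∈ ((⊤ : Subgroup (SurfaceGroup g)).lowerCentralSeries 1))
    (hτ : ∀ x : Fin g × Bool, ψ (PresentedGroup.of x : (SurfaceGroup g)) * (PresentedGroup.of x : (SurfaceGroup g))⁻¹ *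
      (⁅(PresentedGroup.of v : (SurfaceGroup g)), (PresentedGroup.of r : (SurfaceGroup g))⁆ ^
          (if x.1 = u.1 ∧ x.2 = false ∧ u.2 = true then (1 : ℤ) else if x.1 = u.1 ∧ x.2 = true ∧ u.2 = false then (-1 : ℤ) else 0) *
        ⁅(PresentedGroup.of r : (SurfaceGroup g)), (PresentedGroup.of u : (SurfaceGroup g))⁆ ^
          (if x.1 = v.1 ∧ x.2 = false ∧ v.2 = true then (1 : ℤ) else if x.1 = v.1 ∧ x.2 = true ∧ v.2 = false then (-1 : ℤ) else 0) *
        ⁅(PresentedGroup.of u : (SurfaceGroup g)), (PresentedGroup.of v : (SurfaceGroup g))⁆ ^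
          (if x.1 = r.1 ∧ x.2 = false ∧ r.2 = true then (1 : ℤ) else if x.1 = r.1 ∧ x.2 = true ∧ r.2 = false then (-1 : ℤ) else 0))⁻¹ ∈
      ((⊤ : Subgroup (SurfaceGroup g)).lowerCentralSeries 2))
    (M M' : Fin g × Bool → Fin g × Bool → ℤ)
    (hM : ∀ x, toAdd (SurfaceGroup.abelianize g (φ (PresentedGroup.of x))) = fun k => M k x)
    (hM' : ∀ x, toAdd (SurfaceGroup.abelianize g (φ.symm (PresentedGroup.of x))) = fun k => M' k x)
    (cS : Fin g × Bool → Fin g × Bool → (Subgroup.center (SurfaceGroup g ⧸ (⊤ : Subgroup (SurfaceGroup g)).lowerCentralSeries 2)))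
    (hcS : ∀ p q, (cS p q : (SurfaceGroup g ⧸ (⊤ : Subgroup (SurfaceGroup g)).lowerCentralSeries 2)) =
      ⁅((PresentedGroup.of p : (SurfaceGroup g)) : (SurfaceGroup g ⧸ (⊤ : Subgroup (SurfaceGroup g)).lowerCentralSeries 2)), ((PresentedGroup.of q : (SurfaceGroup g)) : (SurfaceGroup g ⧸ (⊤ : Subgroup (SurfaceGroup g)).lowerCentralSeries 2))⁆)
    (t : Fin g × Bool) :
    (((φ.symm.trans (ψ.trans φ)) (PresentedGroup.of t : (SurfaceGroup g)) * (PresentedGroup.of t : (SurfaceGroup g))⁻¹ : (SurfaceGroup g)) : (SurfaceGroup g ⧸ (⊤ : Subgroup (SurfaceGroup g)).lowerCentralSeries 2)) =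
      ((∏ p : Fin g × Bool, ∏ q : Fin g × Bool, cS p q ^
          ((∑ x : Fin g × Bool, M' x t *
              (if x.1 = u.1 ∧ x.2 = false ∧ u.2 = true then (1 : ℤ) else if x.1 = u.1 ∧ x.2 = true ∧ u.2 = false then (-1 : ℤ) else 0)) *
              (M p v * M q r) +
            (∑ x : Fin g × Bool, M' x t *
              (if x.1 = v.1 ∧ x.2 = false ∧ v.2 = true then (1 : ℤ) else if x.1 = v.1 ∧ x.2 = true ∧ v.2 = false then (-1 : ℤ) else 0)) *
              (M p r * M q u) +
            (∑ x : Fin g × Bool, M' x t *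
              (if x.1 = r.1 ∧ x.2 = false ∧ r.2 = true then (1 : ℤ) else if x.1 = r.1 ∧ x.2 = true ∧ r.2 = false then (-1 : ℤ) else 0)) *
              (M p u * M q v)) : (Subgroup.center (SurfaceGroup g ⧸ (⊤ : Subgroup (SurfaceGroup g)).lowerCentralSeries 2))) : (SurfaceGroup g ⧸ (⊤ : Subgroup (SurfaceGroup g)).lowerCentralSeries 2)) := by
  -- abbreviations for the three pairings and the three sums
  set Pu : Fin g × Bool → ℤ := fun x =>
    if x.1 = u.1 ∧ x.2 = false ∧ u.2 = true then (1 : ℤ) else if x.1 = u.1 ∧ x.2 = true ∧ u.2 = false then (-1 : ℤ) else 0 with hPu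
  set Pv : Fin g × Bool → ℤ := fun x =>
    if x.1 = v.1 ∧ x.2 = false ∧ v.2 = true then (1 : ℤ) else if x.1 = v.1 ∧ x.2 = true ∧ v.2 = false then (-1 : ℤ) else 0 with hPv
  set Pr : Fin g × Bool → ℤ := fun x =>
    if x.1 = r.1 ∧ x.2 = false ∧ r.2 = true then (1 : ℤ) else if x.1 = r.1 ∧ x.2 = true ∧ r.2 = false then (-1 : ℤ) else 0 with hPr
  set Au : ℤ := ∑ x : Fin g × Bool, M' x t * Pu x with hAu
  set Av : ℤ := ∑ x : Fin g × Bool, M' x t * Pv x with hAv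
  set Ar : ℤ := ∑ x : Fin g × Bool, M' x t * Pr x with hAr
  -- (1) the Johnson value of `ψ` at `w = φ⁻¹ t`, as a power product of the three seed commutators
  set w : (SurfaceGroup g) := φ.symm (PresentedGroup.of t) with hw
  have hτ' : ∀ x : Fin g × Bool, ((ψ (PresentedGroup.of x : (SurfaceGroup g)) * (PresentedGroup.of x : (SurfaceGroup g))⁻¹ : (SurfaceGroup g)) : (SurfaceGroup g ⧸ (⊤ : Subgroup (SurfaceGroup g)).lowerCentralSeries 2)) =
      ((cS v r ^ Pu x * cS r u ^ Pv x * cS u v ^ Pr x : (Subgroup.center (SurfaceGroup g ⧸ (⊤ : Subgroup (SurfaceGroup g)).lowerCentralSeries 2))) : (SurfaceGroup g ⧸ (⊤ : Subgroup (SurfaceGroup g)).lowerCentralSeries 2)) := by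
    intro x
    rw [(mul_inv_mem_iff_quot _ _ _).1 (hτ x), quot_triple]
    simp only [Subgroup.coe_mul, Subgroup.coe_zpow, hcS, hPu, hPv, hPr]
  have h1 : ((ψ w * w⁻¹ : (SurfaceGroup g)) : (SurfaceGroup g ⧸ (⊤ : Subgroup (SurfaceGroup g)).lowerCentralSeries 2)) = ((cS v r ^ Au * cS r u ^ Av * cS u v ^ Ar : (Subgroup.center (SurfaceGroup g ⧸ (⊤ : Subgroup (SurfaceGroup g)).lowerCentralSeries 2))) : (SurfaceGroup g ⧸ (⊤ : Subgroup (SurfaceGroup g)).lowerCentralSeries 2)) := by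
    rw [ia_quot_eq_prod_zpow ψ hψ (fun x => cS v r ^ Pu x * cS r u ^ Pv x * cS u v ^ Pr x)
      (fun x => by simp only [Subgroup.coe_mul, Subgroup.coe_zpow]; exact (hτ' x).symm) w]
    congr 1
    rw [hw, hM' t]
    simp only [mul_zpow, ← zpow_mul, Finset.prod_mul_distrib, ← zpow_finset_sum, hAu, hAv, hAr]
    simp only [mul_comm (M' _ t)]
  -- (2) apply `φ`: an exact representative of the right-hand side of (1)
  have h2 : ((φ (ψ w * w⁻¹) : (SurfaceGroup g)) : (SurfaceGroup g ⧸ (⊤ : Subgroup (SurfaceGroup g)).lowerCentralSeries 2)) =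
      ((φ (⁅(PresentedGroup.of v : (SurfaceGroup g)), PresentedGroup.of r⁆ ^ Au *
            ⁅(PresentedGroup.of r : (SurfaceGroup g)), PresentedGroup.of u⁆ ^ Av *
            ⁅(PresentedGroup.of u : (SurfaceGroup g)), PresentedGroup.of v⁆ ^ Ar) : (SurfaceGroup g)) : (SurfaceGroup g ⧸ (⊤ : Subgroup (SurfaceGroup g)).lowerCentralSeries 2)) := by
    apply quot_congr_equiv φ
    rw [h1, quot_triple]
    simp only [Subgroup.coe_mul, Subgroup.coe_zpow, hcS]
  rw [conj_tau, ← hw, h2, map_mul, map_mul, map_zpow, map_zpow, map_zpow, QuotientGroup.mk_mul, QuotientGroup.mk_mul,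
    QuotientGroup.mk_zpow, QuotientGroup.mk_zpow, QuotientGroup.mk_zpow,
    quot_equiv_commutator_eq_prod_zpow φ M hM cS hcS, quot_equiv_commutator_eq_prod_zpow φ M hM cS hcS,
    quot_equiv_commutator_eq_prod_zpow φ M hM cS hcS, ← Subgroup.coe_zpow, ← Subgroup.coe_zpow, ← Subgroup.coe_zpow,
    ← Subgroup.coe_mul, ← Subgroup.coe_mul]
  congr 1
  simp only [← Finset.prod_zpow, ← zpow_mul, ← Finset.prod_mul_distrib, ← zpow_add]
  refine Finset.prod_congr rfl fun p _ => Finset.prod_congr rfl fun q _ => ?_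
  congr 1
  ring

end Conj

/-! ## Reading a Johnson table through an erasing projection -/

section Reading

variable {g : ℕ}

/-- Antisymmetrising a double product of powers of an antisymmetric pairing `cc` (`cc w v = (cc v w)⁻¹`,
`cc v v = 1`) into the pair-product normal form over `v < w`. [folklore] -/
theorem prod_prod_zpow_antisymm {Z : Type*} [CommGroup Z] (cc : Fin g → Fin g → Z)
    (hanti : ∀ v w, cc w v = (cc v w)⁻¹) (hdiag : ∀ v, cc v v = 1) (e : Fin g → Fin g → ℤ) :
    ∏ v, ∏ w, cc v w ^ e v w = ∏ v, ∏ w, if v < w then cc v w ^ (e v w - e w v) else 1 := by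
  have hsplit : ∀ v w, cc v w ^ e v w =
      (if v < w then cc v w ^ e v w else 1) * (if w < v then cc v w ^ e v w else 1) := by
    intro v w
    rcases lt_trichotomy v w with h | rfl | h
    · rw [if_pos h, if_neg (lt_asymm h), mul_one]
    · rw [if_neg (lt_irrefl _), hdiag, one_zpow, mul_one]
    · rw [if_neg (lt_asymm h), if_pos h, one_mul]
  have hB : (∏ v, ∏ w, (if w < v then cc v w ^ e v w else (1 : Z))) =
      ∏ v, ∏ w, (if v < w then cc v w ^ (-e w v) else 1) := by
    rw [Finset.prod_comm]
    refine Finset.prod_congr rfl fun v _ => Finset.prod_congr rfl fun w _ => ?_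
    split_ifs with h
    · rw [hanti v w, inv_zpow']
    · rfl
  calc (∏ v, ∏ w, cc v w ^ e v w)
      = ∏ v, ∏ w, ((if v < w then cc v w ^ e v w else 1) * (if w < v then cc v w ^ e v w else 1)) :=
        Finset.prod_congr rfl fun v _ => Finset.prod_congr rfl fun w _ => hsplit v w
    _ = (∏ v, ∏ w, (if v < w then cc v w ^ e v w else (1 : Z))) *
          ∏ v, ∏ w, (if v < w then cc v w ^ (-e w v) else (1 : Z)) := by
        rw [← hB]; simp only [Finset.prod_mul_distrib]
    _ = ∏ v, ∏ w, ((if v < w then cc v w ^ e v w else (1 : Z)) * (if v < w then cc v w ^ (-e w v) else 1)) := by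
        simp only [Finset.prod_mul_distrib]
    _ = ∏ v, ∏ w, if v < w then cc v w ^ (e v w - e w v) else 1 :=
        Finset.prod_congr rfl fun v _ => Finset.prod_congr rfl fun w _ => by
          split_ifs
          · rw [← zpow_add, sub_eq_add_neg]
          · rw [mul_one]

/-- Collapsing a product over the two letters of a handle when the factor at the cut letter is trivial.
[folklore] -/
theorem prod_bool_eq_of_cut {Z : Type*} [CommMonoid Z] (f : Bool → Z) (c : Bool) (hc : f c = 1) :
    ∏ b, f b = f (!c) := by
  rw [Fintype.prod_bool]
  cases c
  · rw [hc, mul_one]; rfl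
  · rw [hc, one_mul]; rfl

/-- **Reading a Johnson table through the erasing projection of a cut pattern** (see the module docstring):
if `ψ(t) t⁻¹ ≡ ∏_{p,q} ⁅p,q⁆ ^ E(t,p,q)` for all letters `t`, then at the cut letter `xⱼ = (j, ct j)` the
correction reads, through `π` (cut letters `↦ 1`, survivor `yₕ = (h, ¬ct h) ↦ of h`),
`π(ψ(xⱼ) xⱼ⁻¹) ≡ ∏_{v<w} ⁅of v, of w⁆ ^ (E(xⱼ,y_v,y_w) - E(xⱼ,y_w,y_v)) (mod γ₃ F)`. [folklore] -/
theorem reading_of_table (ct : Fin g → Bool) (π : (SurfaceGroup g) →* FreeGroup (Fin g)) (hπs : Function.Surjective π)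
    (hπ : ∀ (h : Fin g) (b : Bool), π (PresentedGroup.of (h, b)) = if b = ct h then 1 else FreeGroup.of h)
    (ψ : (SurfaceGroup g) ≃* (SurfaceGroup g)) (cS : Fin g × Bool → Fin g × Bool → (Subgroup.center (SurfaceGroup g ⧸ (⊤ : Subgroup (SurfaceGroup g)).lowerCentralSeries 2)))
    (hcS : ∀ p q, (cS p q : (SurfaceGroup g ⧸ (⊤ : Subgroup (SurfaceGroup g)).lowerCentralSeries 2)) =
      ⁅((PresentedGroup.of p : (SurfaceGroup g)) : (SurfaceGroup g ⧸ (⊤ : Subgroup (SurfaceGroup g)).lowerCentralSeries 2)), ((PresentedGroup.of q : (SurfaceGroup g)) : (SurfaceGroup g ⧸ (⊤ : Subgroup (SurfaceGroup g)).lowerCentralSeries 2))⁆)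
    (E : Fin g × Bool → Fin g × Bool → Fin g × Bool → ℤ)
    (hE : ∀ t, ((ψ (PresentedGroup.of t) * (PresentedGroup.of t)⁻¹ : (SurfaceGroup g)) : (SurfaceGroup g ⧸ (⊤ : Subgroup (SurfaceGroup g)).lowerCentralSeries 2)) =
      ((∏ p : Fin g × Bool, ∏ q : Fin g × Bool, cS p q ^ E t p q : (Subgroup.center (SurfaceGroup g ⧸ (⊤ : Subgroup (SurfaceGroup g)).lowerCentralSeries 2))) : (SurfaceGroup g ⧸ (⊤ : Subgroup (SurfaceGroup g)).lowerCentralSeries 2)))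
    (j : Fin g) :
    π (ψ (PresentedGroup.of (j, ct j)) * (PresentedGroup.of (j, ct j))⁻¹) *
      (((List.finRange g).map (fun v => ((List.finRange g).map (fun w =>
        if v < w then ⁅(FreeGroup.of v : FreeGroup (Fin g)), FreeGroup.of w⁆ ^
          (E (j, ct j) (v, !ct v) (w, !ct w) - E (j, ct j) (w, !ct w) (v, !ct v))
        else (1 : FreeGroup (Fin g)))).prod)).prod)⁻¹ ∈
      (⊤ : Subgroup (FreeGroup (Fin g))).lowerCentralSeries 2 := by
  set F := FreeGroup (Fin g) with hF
  set Γ₃ := (⊤ : Subgroup (FreeGroup (Fin g))).lowerCentralSeries 2 with hΓ₃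
  have hle : ((⊤ : Subgroup (SurfaceGroup g)).lowerCentralSeries 2) ≤ Γ₃.comap π := fun s hs => map_lcs_mem π hs
  set πbar : (SurfaceGroup g ⧸ (⊤ : Subgroup (SurfaceGroup g)).lowerCentralSeries 2) →* F ⧸ Γ₃ := QuotientGroup.map _ Γ₃ π hle with hπbardef
  have hπbar : ∀ s : (SurfaceGroup g), πbar (s : (SurfaceGroup g ⧸ (⊤ : Subgroup (SurfaceGroup g)).lowerCentralSeries 2)) = ((π s : F) : F ⧸ Γ₃) := fun s => rfl
  have hπbars : Function.Surjective πbar := by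
    intro y
    obtain ⟨f, rfl⟩ := QuotientGroup.mk_surjective y
    obtain ⟨s, rfl⟩ := hπs f
    exact ⟨s, rfl⟩
  -- restriction of `πbar` to the centres
  have hcen : ∀ z : (Subgroup.center (SurfaceGroup g ⧸ (⊤ : Subgroup (SurfaceGroup g)).lowerCentralSeries 2)), πbar (z : (SurfaceGroup g ⧸ (⊤ : Subgroup (SurfaceGroup g)).lowerCentralSeries 2)) ∈ center (F ⧸ Γ₃) := fun z => by
    rw [mem_center_iff]
    intro y
    obtain ⟨q, rfl⟩ := hπbars y
    rw [← map_mul, ← map_mul, mem_center_iff.1 z.2 q]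
  set πZ : (Subgroup.center (SurfaceGroup g ⧸ (⊤ : Subgroup (SurfaceGroup g)).lowerCentralSeries 2)) →* center (F ⧸ Γ₃) := (πbar.comp (Subgroup.subtype (Subgroup.center (SurfaceGroup g ⧸ (⊤ : Subgroup (SurfaceGroup g)).lowerCentralSeries 2)))).codRestrict _ (fun z => hcen z) with hπZdef
  have hπZ : ∀ z : (Subgroup.center (SurfaceGroup g ⧸ (⊤ : Subgroup (SurfaceGroup g)).lowerCentralSeries 2)), (πZ z : F ⧸ Γ₃) = πbar (z : (SurfaceGroup g ⧸ (⊤ : Subgroup (SurfaceGroup g)).lowerCentralSeries 2)) := fun z => rfl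
  -- the letter pairing downstairs and the survivor pairing
  set cz : Fin g × Bool → Fin g × Bool → center (F ⧸ Γ₃) := fun p q => πZ (cS p q) with hcz
  have hcz_val : ∀ p q, (cz p q : F ⧸ Γ₃) =
      ⁅((π (PresentedGroup.of p) : F) : F ⧸ Γ₃), ((π (PresentedGroup.of q) : F) : F ⧸ Γ₃)⁆ := by
    intro p q
    rw [hcz, hπZ, hcS, ← quot_commutatorElement, hπbar, map_commutatorElement, quot_commutatorElement]
  obtain ⟨cc, hcc⟩ : ∃ cc : Fin g → Fin g → center (F ⧸ Γ₃),
      ∀ v w, (cc v w : F ⧸ Γ₃) = ⁅((FreeGroup.of v : F) : F ⧸ Γ₃), ((FreeGroup.of w : F) : F ⧸ Γ₃)⁆ :=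
    ⟨fun v w => ⟨_, quot_commutator_mem_center _ _⟩, fun v w => rfl⟩
  have hcz_cut_left : ∀ h q, cz (h, ct h) q = 1 := fun h q => Subtype.ext (by
    rw [hcz_val, hπ, if_pos rfl, QuotientGroup.mk_one, commutatorElement_one_left]; rfl)
  have hcz_cut_right : ∀ p h, cz p (h, ct h) = 1 := fun p h => Subtype.ext (by
    rw [hcz_val, hπ h, if_pos rfl, QuotientGroup.mk_one, commutatorElement_one_right]; rfl)
  have hcz_surv : ∀ v w, cz (v, !ct v) (w, !ct w) = cc v w := fun v w => Subtype.ext (by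
    have hv : (!ct v) ≠ ct v := by cases ct v <;> decide
    have hw : (!ct w) ≠ ct w := by cases ct w <;> decide
    rw [hcz_val, hπ, hπ, if_neg hv, if_neg hw, hcc])
  -- the double product over letters collapses to the survivors
  have hcollapse : ∀ t, (∏ p : Fin g × Bool, ∏ q : Fin g × Bool, cz p q ^ E t p q) =
      ∏ v : Fin g, ∏ w : Fin g, cc v w ^ E t (v, !ct v) (w, !ct w) := by
    intro t
    have hrow : ∀ p : Fin g × Bool, (∏ q : Fin g × Bool, cz p q ^ E t p q) =
        ∏ w : Fin g, cz p (w, !ct w) ^ E t p (w, !ct w) := by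
      intro p
      rw [Fintype.prod_prod_type]
      refine Finset.prod_congr rfl fun w _ => ?_
      exact prod_bool_eq_of_cut (fun b => cz p (w, b) ^ E t p (w, b)) (ct w) (by
        simp only [hcz_cut_right, one_zpow])
    simp only [hrow]
    rw [Fintype.prod_prod_type]
    refine Finset.prod_congr rfl fun v _ => ?_
    rw [prod_bool_eq_of_cut (fun b => ∏ w : Fin g, cz (v, b) (w, !ct w) ^ E t (v, b) (w, !ct w)) (ct v) (by
      simp only [hcz_cut_left, one_zpow, Finset.prod_const_one])]
    simp only [hcz_surv]
  have hanti : ∀ v w, cc w v = (cc v w)⁻¹ := fun v w => Subtype.ext (by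
    rw [Subgroup.coe_inv, hcc, hcc, commutatorElement_inv])
  have hdiag : ∀ v, cc v v = 1 := fun v => Subtype.ext (by
    rw [hcc, commutatorElement_self, Subgroup.coe_one])
  -- the chain of equalities in `F ⧸ γ₃ F`
  rw [mul_inv_mem_iff_quot, ← QuotientGroup.mk'_apply, ← QuotientGroup.mk'_apply, pp_map]
  have lhs : (QuotientGroup.mk' Γ₃) (π (ψ (PresentedGroup.of (j, ct j)) * (PresentedGroup.of (j, ct j))⁻¹)) =
      ((∏ v : Fin g, ∏ w : Fin g, (if v < w then cc v w ^
          (E (j, ct j) (v, !ct v) (w, !ct w) - E (j, ct j) (w, !ct w) (v, !ct v)) else 1) : center (F ⧸ Γ₃)) : F ⧸ Γ₃) := by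
    rw [QuotientGroup.mk'_apply, ← hπbar, hE, ← hπZ, map_prod]
    simp only [map_prod, map_zpow]
    change ((∏ p : Fin g × Bool, ∏ q : Fin g × Bool, cz p q ^ E (j, ct j) p q : center (F ⧸ Γ₃)) : F ⧸ Γ₃) = _
    rw [hcollapse, prod_prod_zpow_antisymm cc hanti hdiag]
  rw [lhs, ← pp_eq_coe_prod cc]
  exact pp_congr _ _ _ _ fun v w _ => by rw [QuotientGroup.mk'_apply, quot_commutatorElement, hcc]

end Reading

/-! ## Registered helper -/

/-- **Registered helper `helper_johnsonConjSeed`** (sub-goal of stub `stub_layerStepOneZero`, crux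
stmt-SmoothPoincare4-14595): the conjugation formula `johnson_conj_seed` in closed form (commutators spelled
out). [folklore] -/
theorem helper_johnsonConjSeed : ∀ (g : ℕ) (u v r : Fin g × Bool) (ψ φ : SurfaceGroup g ≃* SurfaceGroup g), (∀ s : SurfaceGroup g, ψ s * s⁻¹ ∈ (⊤ : Subgroup (SurfaceGroup g)).lowerCentralSeries 1) → (∀ x : Fin g × Bool, ψ (PresentedGroup.of x : SurfaceGroup g) * (PresentedGroup.of x : SurfaceGroup g)⁻¹ * (((PresentedGroup.of v : SurfaceGroup g) * (PresentedGroup.of r : SurfaceGroup g) * (PresentedGroup.of v : SurfaceGroup g)⁻¹ * (PresentedGroup.of r : SurfaceGroup g)⁻¹) ^ (if x.1 = u.1 ∧ x.2 = false ∧ u.2 = true then (1 : ℤ) else if x.1 = u.1 ∧ x.2 = true ∧ u.2 = false then (-1 : ℤ) else 0) * ((PresentedGroup.of r : SurfaceGroup g) * (PresentedGroup.of u : SurfaceGroup g) * (PresentedGroup.of r : SurfaceGroup g)⁻¹ * (PresentedGroup.of u : SurfaceGroup g)⁻¹) ^ (if x.1 = v.1 ∧ x.2 = false ∧ v.2 =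 true then (1 : ℤ) else if x.1 = v.1 ∧ x.2 = true ∧ v.2 = false then (-1 : ℤ) else 0) * ((PresentedGroup.of u : SurfaceGroup g) * (PresentedGroup.of v : SurfaceGroup g) * (PresentedGroup.of u : SurfaceGroup g)⁻¹ * (PresentedGroup.of v : SurfaceGroup g)⁻¹) ^ (if x.1 = r.1 ∧ x.2 = false ∧ r.2 = true then (1 : ℤ) else if x.1 = r.1 ∧ x.2 = true ∧ r.2 = false then (-1 : ℤ) else 0))⁻¹ ∈ (⊤ : Subgroup (SurfaceGroup g)).lowerCentralSeries 2) → ∀ (M M' : Fin g × Bool → Fin g × Bool → ℤ), (∀ x : Fin g × Bool, toAdd (SurfaceGroup.abelianize g (φ (PresentedGroup.of x : SurfaceGroup g))) = fun k => M k x) → (∀ x : Fin g × Bool, toAdd (SurfaceGroup.abelianize g (φ.symm (PresentedGroup.of x : SurfaceGroup g))) = fun k => M' k x) → ∀ (cS : Fin g × Bool → Fin g × Bool → Subgroup.center (SurfaceGroup g ⧸ (⊤ : Subgroup (SurfaceGroup g)).lowerCentralSeries 2)), (∀ p q : Fin g × Bool, (cS p q : SurfaceGroup g ⧸ (⊤ :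 Subgroup (SurfaceGroup g)).lowerCentralSeries 2) = (((PresentedGroup.of p : SurfaceGroup g) : SurfaceGroup g ⧸ (⊤ : Subgroup (SurfaceGroup g)).lowerCentralSeries 2) * ((PresentedGroup.of q : SurfaceGroup g) : SurfaceGroup g ⧸ (⊤ : Subgroup (SurfaceGroup g)).lowerCentralSeries 2) * (((PresentedGroup.of p : SurfaceGroup g) : SurfaceGroup g ⧸ (⊤ : Subgroup (SurfaceGroup g)).lowerCentralSeries 2))⁻¹ * (((PresentedGroup.of q : SurfaceGroup g) : SurfaceGroup g ⧸ (⊤ : Subgroup (SurfaceGroup g)).lowerCentralSeries 2))⁻¹)) → ∀ t : Fin g × Bool, (((φ.symm.trans (ψ.trans φ)) (PresentedGroup.of t : SurfaceGroup g) * (PresentedGroup.of t : SurfaceGroup g)⁻¹ : SurfaceGroup g) : SurfaceGroup g ⧸ (⊤ : Subgroup (SurfaceGroup g)).lowerCentralSeries 2) = ((∏ p : Fin g × Bool, ∏ q : Fin g × Bool, cS p q ^ ((∑ x : Fin g × Bool, M' x t * (if x.1 = u.1 ∧ x.2 = false ∧ u.2 = true then (1 : ℤ) else if x.1 = u.1 ∧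 x.2 = true ∧ u.2 = false then (-1 : ℤ) else 0)) * (M p v * M q r) + (∑ x : Fin g × Bool, M' x t * (if x.1 = v.1 ∧ x.2 = false ∧ v.2 = true then (1 : ℤ) else if x.1 = v.1 ∧ x.2 = true ∧ v.2 = false then (-1 : ℤ) else 0)) * (M p r * M q u) + (∑ x : Fin g × Bool, M' x t * (if x.1 = r.1 ∧ x.2 = false ∧ r.2 = true then (1 : ℤ) else if x.1 = r.1 ∧ x.2 = true ∧ r.2 = false then (-1 : ℤ) else 0)) * (M p u * M q v)) : Subgroup.center (SurfaceGroup g ⧸ (⊤ : Subgroup (SurfaceGroup g)).lowerCentralSeries 2)) : SurfaceGroup g ⧸ (⊤ : Subgroup (SurfaceGroup g)).lowerCentralSeries 2) :=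
  fun _ u v r ψ φ hψ hτ M M' hM hM' cS hcS t => johnson_conj_seed u v r ψ φ hψ hτ M M' hM hM' cS hcS t

end Summit.SmoothPoincare4.SmoothPoincare4.Theorems.ShadowApproximation.NilpotentGenusClass
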